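import Literature.AlgebraicGeometry.Motives.JacobianGaloisDescent
import HarnessLib

/-!
# Galois descent of invariant field-valued points of a separated `k`-scheme
# (Görtz–Wedhorn I, Thm. 14.72 (1))

U. Görtz, T. Wedhorn, *Algebraic Geometry I* (2nd ed. 2020), Thm. 14.72 (1): for a faithfully flat
quasi-compact `S' → S`, morphisms of `S`-schemes satisfy descent — `Hom_S(X, Y)` is the equaliser
of `Hom_{S'}(X', Y') ⇉ Hom_{S''}(X'', Y'')`; with §(14.20) (Galois descent: for `S' = Spec F'`,
`S = Spec F`, `F'/F` finite Galois, the descent datum is an action of `Gal(F'/F)`). This file is the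
**field-valued-point case for an arbitrary separated `k`-scheme `Y`**: an `F'`-point
`y : Spec F' → Y` over `k` (along any `Spec F → Spec k`) which is invariant under the automorphisms
`Spec σ⁻¹` of `Spec F'`, `σ ∈ Gal(F'/F)`, is the restriction of a unique `F`-point. It is a verbatim
generalisation of §3 of `Motives/SymmetricPowerSplitDivisorsDescent` (which treats `Y = C^{(d)}`),
using the tree's descent of morphisms `GaloisDescent.descentScheme` (`Motives/JacobianGaloisDescent`;
`EffectiveEpi.desc` along the flat covering, cocycle checked on the reduced kernel pair):

* `FieldPointDescent.XF`, `YF`, `descentDatum`, `gal_descentDatum`, `descendedLeft`, `descendedMap`,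
  `descendedMap_comp_hom`, `bcSpec_descendedMap`,
  **`FieldPointDescent.exists_fieldPoint_of_gal_invariant`**;
* **`AlgPoints.exists_eq_specOverMapOfAlgHom_of_forall_smul_eq`** — the same in the language of
  `AlgPoints`: for a tower `k → F → F'` with `F'/F` finite Galois and `y ∈ Y(F')` with `σ • y = y`
  for all `σ ∈ Gal(F'/F)` (acting through `AlgPoints.specMap` of `σ|_k`), there is `w ∈ Y(F)` with
  `y = Spec(F → F') ≫ w`.

Used for the descent of the symmetrised point `∑_τ f(Q_τ) ∈ A(M)^{Gal(M/K(r))}` to `A(K(r))` in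
Abel's theorem (Lang, *Abelian Varieties*, II §2 Thm. 10). Everything is proved; the `def`s are
constructions with bodies; no named facts (D-0026).

## References

* U. Görtz, T. Wedhorn, *Algebraic Geometry I*, 2nd ed. (2020), §(14.20), Thm. 14.72 (1).
  [GortzWedhorn2020]
* S. Lang, *Abelian Varieties* (1959/1983), II §2, proof of Thm. 10. [Lang1983AbelianVarieties]
-/

noncomputable section

open CategoryTheory CategoryTheory.Limits AlgebraicGeometry

universe u

namespace Literature.AlgebraicGeometry.Motives

namespace FieldPointDescent

set_option backward.isDefEq.respectTransparency false

open AbelianVariety (bcSpec specAut specAut_mul specAut_one specAut_comp_bcSpec specAut_comp_bcSpec_assoc)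
open GaloisDescent

variable {k : Type u} [Field k] (Y : SchemeOver k)
  (F F' : Type u) [Field F] [Field F'] [Algebra F F'] (π : Spec (.of F) ⟶ Spec (.of k))

/-- `Spec F` as an `F`-scheme. [folklore] -/
abbrev XF : SchemeOver F := Over.mk (𝟙 (Spec (.of F)))

/-- `Y ×_k Spec F` as an `F`-scheme. [folklore] -/
abbrev YF : SchemeOver F := Over.mk (pullback.snd Y.hom π)

/-- The base change `Spec F ×_F Spec F'` of `Spec F` is reduced. [folklore] -/
instance isReduced_bc_XF : IsReduced (bc F' (XF F)) := by
  change IsReduced (pullback (𝟙 (Spec (.of F))) (bcSpec F F'))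
  haveI : IsIso (pullback.snd (𝟙 (Spec (.of F))) (bcSpec F F')) := pullback_snd_iso_of_left_iso _ _
  exact isReduced_of_isOpenImmersion (pullback.snd (𝟙 (Spec (.of F))) (bcSpec F F'))

/-- `Spec F → Spec F` is locally of finite type. [folklore] -/
instance locallyOfFiniteType_XF_hom : LocallyOfFiniteType (XF F).hom := by
  change LocallyOfFiniteType (𝟙 _)
  infer_instance

variable (yl : Spec (.of F') ⟶ Y.left) (hyl : yl ≫ Y.hom = bcSpec F F' ≫ π)

/-- The descent datum: the `F'`-point `y` of `Y` as a morphism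
`Spec F ×_F Spec F' → (Y ×_k Spec F) ×_F Spec F'`. [folklore] -/
def descentDatum : bc F' (XF F) ⟶ bc F' (YF Y F π) :=
  pullback.lift
    (pullback.lift (pullback.snd (XF F).hom (bcSpec F F') ≫ yl)
      (pullback.snd (XF F).hom (bcSpec F F') ≫ bcSpec F F')
      (by rw [Category.assoc, Category.assoc, hyl]))
    (pullback.snd (XF F).hom (bcSpec F F'))
    (pullback.lift_snd _ _ _)

/-- The descent datum lies over `Spec F'`. [folklore] -/
@[reassoc]
theorem descentDatum_snd :
    descentDatum Y F F' π yl hyl ≫ pullback.snd (YF Y F π).hom (bcSpec F F') =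
      pullback.snd (XF F).hom (bcSpec F F') :=
  pullback.lift_snd _ _ _

/-- First coordinate of the descent datum: `pr₂ ≫ y`. [folklore] -/
theorem descentDatum_fst_fst :
    descentDatum Y F F' π yl hyl ≫ pullback.fst (YF Y F π).hom (bcSpec F F') ≫
        pullback.fst Y.hom π = pullback.snd (XF F).hom (bcSpec F F') ≫ yl := by
  rw [descentDatum, pullback.lift_fst_assoc, pullback.lift_fst]

/-- Second coordinate of the descent datum: `pr₂ ≫ (Spec F' → Spec F)`. [folklore] -/
theorem descentDatum_fst_snd :
    descentDatum Y F F' π yl hyl ≫ pullback.fst (YF Y F π).hom (bcSpec F F') ≫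
        pullback.snd Y.hom π = pullback.snd (XF F).hom (bcSpec F F') ≫ bcSpec F F' := by
  rw [descentDatum, pullback.lift_fst_assoc, pullback.lift_snd]

/-- **The descent datum is Galois-equivariant** when `y` is invariant under the automorphisms
`Spec σ⁻¹` of `Spec F'`. [folklore] -/
theorem gal_descentDatum (hinv : ∀ σ : F' ≃ₐ[F] F', specAut F' σ⁻¹ ≫ yl = yl) (σ : F' ≃ₐ[F] F') :
    gal F' (XF F) σ ≫ descentDatum Y F F' π yl hyl =
      descentDatum Y F F' π yl hyl ≫ gal F' (YF Y F π) σ := by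
  apply pullback.hom_ext
  · rw [Category.assoc, Category.assoc, gal_fst]
    apply pullback.hom_ext
    · rw [Category.assoc, Category.assoc, descentDatum_fst_fst, gal_snd_assoc, hinv]
    · rw [Category.assoc, Category.assoc, descentDatum_fst_snd, gal_snd_assoc, specAut_comp_bcSpec]
  · rw [Category.assoc, Category.assoc, descentDatum_snd, gal_snd, gal_snd, descentDatum_snd_assoc]

variable [IsSeparated Y.hom]

/-- `Y_F → Spec F` is separated. [folklore] -/
instance isSeparated_YF_hom : IsSeparated (YF Y F π).hom := by
  change IsSeparated (pullback.snd Y.hom π)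
  infer_instance

variable [FiniteDimensional F F'] [IsGalois F F'] (hinv : ∀ σ : F' ≃ₐ[F] F', specAut F' σ⁻¹ ≫ yl = yl)

/-- The descended morphism `Spec F → Y ×_k Spec F`. [folklore] -/
def descendedLeft : Spec (.of F) ⟶ (YF Y F π).left :=
  descentScheme F' (X := XF F) (Y := YF Y F π) (descentDatum Y F F' π yl hyl)
    (descentDatum_snd Y F F' π yl hyl) (gal_descentDatum Y F F' π yl hyl hinv)

/-- The defining property of the descended morphism. [folklore] -/
theorem fst_descendedLeft :
    pullback.fst (XF F).hom (bcSpec F F') ≫ descendedLeft Y F F' π yl hyl hinv =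
      descentDatum Y F F' π yl hyl ≫ pullback.fst (YF Y F π).hom (bcSpec F F') :=
  fst_descentScheme F' (X := XF F) (Y := YF Y F π) _ _ _

/-- The descended morphism `Spec F → Y`. [folklore] -/
def descendedMap : Spec (.of F) ⟶ Y.left :=
  descendedLeft Y F F' π yl hyl hinv ≫ pullback.fst Y.hom π

/-- The descended morphism lies over `π : Spec F → Spec k`. [folklore] -/
theorem descendedMap_comp_hom :
    descendedMap Y F F' π yl hyl hinv ≫ Y.hom = π := by
  set f := pullback.fst (XF F).hom (bcSpec F F') with hf
  haveI : Epi f := inferInstance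
  have hP : pullback.snd (XF F).hom (bcSpec F F') ≫ bcSpec F F' = f := by
    rw [← pullback.condition]
    exact Category.comp_id _
  have key : f ≫ descendedLeft Y F F' π yl hyl hinv ≫ pullback.fst Y.hom π ≫ Y.hom = f ≫ π := by
    rw [(reassoc_of% fst_descendedLeft Y F F' π yl hyl hinv), pullback.condition,
      (reassoc_of% descentDatum_fst_snd Y F F' π yl hyl), ← Category.assoc, hP]
  have key2 : f ≫ (descendedMap Y F F' π yl hyl hinv ≫ Y.hom) = f ≫ π :=
    (congrArg (f ≫ ·) (Category.assoc _ _ _)).trans key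
  exact (cancel_epi f).1 key2

/-- **The descended morphism restricts to `y` over `F'`.** [cite: GortzWedhorn2020, Thm. 14.72 (1)] -/
theorem bcSpec_descendedMap : bcSpec F F' ≫ descendedMap Y F F' π yl hyl hinv = yl := by
  set e : Spec (.of F') ⟶ bc F' (XF F) := pullback.lift (bcSpec F F') (𝟙 _)
    ((Category.comp_id _).trans (Category.id_comp _).symm) with he
  have he1 : e ≫ pullback.fst (XF F).hom (bcSpec F F') = bcSpec F F' := pullback.lift_fst _ _ _
  have he2 : e ≫ pullback.snd (XF F).hom (bcSpec F F') = 𝟙 _ := pullback.lift_snd _ _ _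
  calc bcSpec F F' ≫ descendedMap Y F F' π yl hyl hinv
      = (e ≫ pullback.fst (XF F).hom (bcSpec F F')) ≫ descendedMap Y F F' π yl hyl hinv := by
        rw [he1]
    _ = e ≫ pullback.fst (XF F).hom (bcSpec F F') ≫
          descendedLeft Y F F' π yl hyl hinv ≫ pullback.fst Y.hom π :=
        Category.assoc _ _ _
    _ = e ≫ descentDatum Y F F' π yl hyl ≫ pullback.fst (YF Y F π).hom (bcSpec F F') ≫
          pullback.fst Y.hom π :=
        congrArg (e ≫ ·) ((reassoc_of% fst_descendedLeft Y F F' π yl hyl hinv) _)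
    _ = e ≫ pullback.snd (XF F).hom (bcSpec F F') ≫ yl :=
        congrArg (e ≫ ·) (descentDatum_fst_fst Y F F' π yl hyl)
    _ = (e ≫ pullback.snd (XF F).hom (bcSpec F F')) ≫ yl := (Category.assoc _ _ _).symm
    _ = yl := by rw [he2, Category.id_comp]

include hyl hinv in
/-- **Galois descent of invariant field-valued points** (Görtz–Wedhorn I, Thm. 14.72 (1), descent
of morphisms along `Spec F' → Spec F`): an `F'`-valued point of a separated `k`-scheme `Y` over
`k` (`F'/F` finite Galois, `Spec F → Spec k` arbitrary) which is invariant under the automorphisms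
`Spec σ⁻¹`, `σ ∈ Gal(F'/F)`, is the restriction of an `F`-valued point.
[cite: GortzWedhorn2020, Thm. 14.72 (1)] -/
theorem exists_fieldPoint_of_gal_invariant :
    ∃ w : Over.mk π ⟶ Y, bcSpec F F' ≫ w.left = yl :=
  ⟨Over.homMk (descendedMap Y F F' π yl hyl hinv) (descendedMap_comp_hom Y F F' π yl hyl hinv),
    bcSpec_descendedMap Y F F' π yl hyl hinv⟩

end FieldPointDescent

/-- **Galois descent of invariant points, in the language of `AlgPoints`**: for a separated
`k`-scheme `Y`, a tower of fields `k → F → F'` with `F'/F` finite Galois, and an `F'`-point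
`y ∈ Y(F')` fixed by `Gal(F'/F)` (acting through `AlgPoints.specMap`, i.e. `σ • y = y` for the
`k`-automorphisms `σ|_k`), there is an `F`-point `w ∈ Y(F)` restricting to `y`.
[cite: GortzWedhorn2020, Thm. 14.72 (1)] -/
theorem AlgPoints.exists_eq_specOverMapOfAlgHom_of_forall_smul_eq {k : Type u} [Field k]
    {Y : SchemeOver k} [IsSeparated Y.hom] (F F' : Type u) [Field F] [Field F'] [Algebra k F]
    [Algebra k F'] [Algebra F F'] [IsScalarTower k F F'] [FiniteDimensional F F'] [IsGalois F F']
    (y : AlgPoints Y F') (hy : ∀ σ : F' ≃ₐ[F] F', (σ.restrictScalars k) • y = y) :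
    ∃ w : AlgPoints Y F, y = AlgPoints.specOverMapOfAlgHom (IsScalarTower.toAlgHom k F F') ≫ w := by
  have hyl : y.left ≫ Y.hom = AbelianVariety.bcSpec F F' ≫ Spec.map (CommRingCat.ofHom (algebraMap k F)) := by
    rw [Over.w y]
    change Spec.map (CommRingCat.ofHom (algebraMap k F')) = _
    rw [← Spec.map_comp, ← CommRingCat.ofHom_comp, ← IsScalarTower.algebraMap_eq]
  have hinv : ∀ σ : F' ≃ₐ[F] F', AbelianVariety.specAut F' σ⁻¹ ≫ y.left = y.left := by
    intro σ
    have h := congrArg (fun z : AlgPoints Y F' => z.left) (hy σ⁻¹)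
    exact h
  obtain ⟨w, hw⟩ := FieldPointDescent.exists_fieldPoint_of_gal_invariant Y F F'
    (Spec.map (CommRingCat.ofHom (algebraMap k F))) y.left hyl hinv
  refine ⟨w, ?_⟩
  apply Over.OverMorphism.ext
  rw [Over.comp_left, AlgPoints.specOverMapOfAlgHom_left, ← hw]
  rfl

end Literature.AlgebraicGeometry.Motives
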